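import Summits.ABC.IUTFork.Joshi.TestIsmScalingShells
import HarnessLib

/-!
# Block E, test X-07′ — the «Joshi-style (Ind2)» instantiation at the pinned carriers, I: the MODEL

Record file (D-0012) of the abc-iut cell, block E «type Joshi's construction, test vs S» (rung LADDER-ABC:A2.E; seat abc-iut-E-t41,
slot T-41 = test row **X-07′** of plan/E/cx/TEST-LEDGER.md; rulings abc-iut-E-plan 2026-08-26T06:50:08Z / 06:55:58Z, design and sign-off
criterion abc-iut-E-cx 06:43:20Z / 06:50:46Z). TAKES NO SIDE on [IUTchIII] Cor. 3.12, on Joshi's claims or on Mochizuki's report on them;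
introduces NO `Prop` fact. A model EXHIBITS the satisfiability of typed hypotheses, nothing more.

WHAT IS TESTED. The cell's residual of record is S := `Cor312Vol.PilotKummerIndRelated S P ρ qK` (Cor312PinnedRegionsThreePins l.145). Test
row X-06 (abc-iut-E-cx, `Joshi.not_untiltChange_of_logvolInvariant`, Joshi/TestHarness p428758) shows: at every setting whose (Ind1)/(Ind2)
preserve log-volume, Joshi's «untilt change as an indeterminacy» (Y₁ = `Joshi.UntiltChangeIsInd`) cannot cover the q-pilot region. The first
X-07 specification («enlarge `LogShells.ism` by a non-isometric σ and get S ∧ P.Statement») is UNSATISFIABLE (E-cx 06:43:20Z, accepted by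
E-plan 06:50:08Z): `Cor312.Setting.possibleImages` ranges over the whole subgroup `indGroup = Subgroup.closure (Ind1Family ∪ Ind2Family)`
(Cor312Statement l.278/l.287), so the powers of σ make `⋃₀ possibleImages` escape every hull-set, `HullDefined` fails and `−|log(Θ)| = ⊤`.
X-07′ := EXHIBIT that instantiation anyway and record, in kernel currency, BOTH what it reaches (S) and what it breaks (the typed Statement,
`BridgeHyps.finite`), with a pins report. THIS FILE is part I (the model, its typed [IUTchIII] Theorem 3.11, the setting); see FILES below.

THE MODEL = abc-iut-w4-d101's pinned naive `p`-adic model of record (`Cor312Vol.PinnedWitness.pinnedSetting` over abc-iut-w5-d247's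
`NaiveWitness.naiveFull`: carrier `log(𝒟⊢_v) = ℚ` over c312-7's one-place index `toyIndex`, packets = ℚ-lines `line j vQ`, regions the
`p`-adic balls `B_k = pBall p j vQ k`, log-volume `μ(B_k) = −k·log p`, splitting monoid `Ψ_v = {(±q^{j²})_j}`, honest exponent-reading
Prop. 3.7 output `pinSig`, Θ-glue `B_{k·j²}`, q-glue `B_k`) with EXACTLY ONE signature field changed:
`LogShells.ism v := Set.univ` — "Ism" := ALL ℚ-linear automorphisms of the line `log(𝒟⊢_v)`, i.e. all scalings `x ↦ c·x`, `c ≠ 0`,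
containing the valuation-rescalings `x ↦ p^k·x` next to the signs `{±1}` of the model of record. This is the reading K. Joshi prints for
Mochizuki's (Ind2): «indeterminacy with respect to ℚ_p-linear isomorphisms σ : Ĝ_m(𝒪_{ℂ♭_p}) → Ĝ_m(𝒪_{ℂ♭_p})» (K. Joshi, *Construction of
Arithmetic Teichmüller Spaces III*, arXiv:2401.13508v4, §8.11.1, p. 91 l. 44–46 = plan/E/lit/OBJECT-LOCATORS.tsv EL-040; the valuation
rescaling itself: Thm. 4.2.2.1 (4) eq. (4.2.2.2) `|−|_{K_{y′_{w,j}}} = |−|^{j²}_{K_{y′_{w,1}}}`, p. 33; second print home Prop. 10.3.3 (2),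
p. 132 l. 4–23 (abc-iut-E-t34's typing)), versus S. Mochizuki, *Inter-universal Teichmüller theory III* (kurims `paper:url-4b091feeb646`),
Thm. 3.11 (i) (Ind2) p. 154 «independent copies of Ism» / Prop. 1.2 (vi), [IUTchII] Ex. 1.8 (iv) «Ism» (isometries; E-lit EL-079). In the
tree `LogShells.ism` is an abstract binder (`one_mem_ism` only, Thm311Sig l.186–191), so BOTH instantiations are instances of the typed
Theorem 3.11; which one [IUTchIII] intends is the E6 attach point — recorded, not adjudicated.

ZERO-LABEL CONVENTION (forced, flagged): the pins `ThetaPinned`/`QPinned` quantify over every label `j : |𝔽_l|`, including `j = 0 ∉ 𝔽_l^⋇`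
where no pilot object has a component ([IUTchIII] Def. 3.8 (i): objects of `∏_{j ∈ 𝔽_l^⋇}`) and which the Corollary never reads. The model
of record puts the convention `𝒪 = B_0` there (Cor312PinnedOperators l.14–18). Once (Ind2) rescales valuations, NO ball is invariant at the
component-free label while (hρ) demands invariance there, so the only equivariant hull-set conventions are `∅`/univ; this model puts
`Set.univ` (one-hull-set frame `univFrame`, admissible with log-volume `0`) at `j = 0` on the Θ-glue, the q-glue and the frame. Every
quantity of Cor. 3.12 (`thetaLocal`, `qLocal`, `negLogTheta`, `negLogQ`, `Statement`, `BridgeHyps.mono/image_adm/theta_nonempty`) reads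
the labels `labelSucc i ∈ 𝔽_l^⋇` only, where the model is the honest ball model.

FILES (three, Test* glob R14): `TestIsmScalingShells` (part 0: the ℚ-line shells `lineShells A I`, `scalShells := lineShells signs univ`,
every packet automorphism a nonzero SCALAR (`exists_scalar`), `image_pBall_of_scalar`, the explicit (Ind2)-families `scaleFamily u` —
«`u_j` on the factor `0`, `1` on the other factors», E-plan 06:50:08Z (a) —, `untiltFamily`, `dilateFamily`) ⟵ THIS FILE (part I: §2 data
(a)(b)(c), degrees, column = w5-d247's sign-twisted Kummer transport verbatim, link data = w5-d247's `naiveLink`, and the typed Theorem 3.11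
(i) ∧ (ii) ∧ (iii) PROVED, `scalFull_statement`; §3 the setting `scalSetting` = pinnedSetting's honest object side verbatim with glue reading
the objects, its pilot objects / regions COMPUTED, and **`scalSetting_possibleImages`: at every label of `𝔽_l^⋆` the possible images of
the Θ-pilot object are ALL the balls `{B_e}_{e ∈ ℤ}`, whose union is the whole packet line**) ⟵ `TestIsmScalingResults` (part II: the test
theorems (a) S, (b′) hull blow-up, (c) ¬LogvolInvariant, (d) pins report, and the BridgeHyps clause census).
Interface-level witness over `toyIndex` (`l⋇ = 2`); NOT a model of initial Θ-data; no judgement on print; typed ≠ proved ≠ endorsed.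
[claim: Mochizuki2012, status: disputed] [claim: Joshi2024ATS3, status: disputed] [cite: ScholzeStix2018, §2.2 pp. 9–10]
-/

noncomputable section

open Set

namespace Summit.ABC.IUTFork.Joshi.IsmScaling

open Thm311 Cor312 Cor312.Checks Cor312.IdentifiedNonVacuity Cor312Vol Cor312Vol.NaiveWitness Cor312Vol.PinnedWitness
  Literature.IUT.LogThetaLattice

variable (p : ℕ)

/-! ## 2. Data (a)(b)(c), column, link data; the typed Theorem 3.11 holds -/

/-- **The data (a)(b)(c) of [IUTchIII] Thm. 3.11 (i)** of the model: w5-d247's `naiveData` verbatim (integral structures `B_0`, admissible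
regions the balls, log-volume `μ(B_k) = −k·log p`, splitting monoid `Ψ_v = {(±q^{j²})_j}` acting by coordinatewise multiplication, number
field the global packet) on the Joshi-style shells, plus the zero-label convention: `univ` is admissible at `j = 0` (module docstring).
[claim: Mochizuki2012, status: disputed] -/
def scalData : MRData scalShells where
  shellPk := fun j vQ => pBall p j vQ 0
  shellSub := fun j v => pBall p j (toyIndex.over v) 0
  Adm := fun j vQ A => (j = 0 ∧ A = Set.univ) ∨ ∃ k, A = pBall p j vQ k
  logvol := fun j vQ A => pVol p j vQ A
  Ψ := fun v _ => Psi p v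
  act := fun v _ y => LinearMap.pi fun j => (line j.1 (toyIndex.over v) (y j)) • LinearMap.proj j
  Mmod := fun _ => Set.univ

/-- **(c)'s global realified Frobenioids** of the model: w5-d247's `naiveDegrees` verbatim (objects `p^k𝒪`, degree `−k·log p`, region
`B_k`). [claim: Mochizuki2012, status: disputed] -/
def scalDegrees (j : toyIndex.LabelStar) : GlobalDegrees scalShells j where
  ObjMOD := ℤ
  Objmod := ℤ
  natIso := Equiv.refl ℤ
  deg := fun k => -(k : ℝ) * Real.log p
  region := fun k vQ => pBall p j.1 vQ k

/-- The SITUATION of the model: Joshi-style shells, the same data on every vertical line (bi-coric strictification). An `abbrev`, so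
that `(scalSituation p).L` reduces to `scalShells`. [claim: Mochizuki2012, status: disputed] -/
abbrev scalSituation : Situation toyIndex where
  L := scalShells
  D := fun _ => scalData p
  G := fun _ j => scalDegrees p j

/-- **The column** of the model: w5-d247's `naiveColumn` verbatim (Kummer transport at `(n,m)` twisted by the sign `(−1)^m ∈ Ism`,
unit-group images `B_{m'+1}`, Frobenioid objects tagged copies of `ℤ`, Θ-pilot the object of exponent `1`), admissibility read through
the zero-label convention. [claim: Mochizuki2012, status: disputed] -/
def scalColumn : Column scalShells where
  frobAdm := fun m j vQ A => (j = 0 ∧ twist m j vQ '' A = Set.univ) ∨ ∃ k, twist m j vQ '' A = pBall p j vQ k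
  frobLogvol := fun m j vQ A => pVol p j vQ (twist m j vQ '' A)
  frobΨ := fun m v _ => scalShells.starAut (twist m) v '' Psi p v
  frobMmod := fun m j => scalShells.globalAut (twist m) j.1 '' Set.univ
  unitImage := fun _ m' j vQ => pBall p j vQ ((m' : ℤ) + 1)
  ballImage := fun _ j vQ => pBall p j vQ 0
  ObjLGP := ℤ
  frobObjLGP := FrobObj
  kumLGP := kum
  ObjLgp := ℤ
  frobObjLgp := FrobObj
  kumLgp := kum
  thetaPilot := fun m => ⟨(1, m), rfl⟩

/-- **The full situation of the typed [IUTchIII] Thm. 3.11** for the model (link data: w5-d247's `naiveLink`). An `abbrev`.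
[claim: Mochizuki2012, status: disputed] -/
abbrev scalFull : FullSituation toyIndex where
  toSituation := scalSituation p
  col := fun _ => scalColumn p
  link := naiveLink

/-- Over the one-place index the sub-packet `𝓘^ℚ(^{S^±_{j+1},j};𝒟^⊢_v)` is the whole packet (as for `signShells`). [folklore] -/
theorem subPacket_eq_top (j : toyIndex.Label) (v : toyIndex.V) : scalShells.SubPacket j v = ⊤ := by
  haveI : Subsingleton toyIndex.V := inferInstanceAs (Subsingleton Unit)
  refine top_unique fun x _ => ?_
  have hx : x ∈ Submodule.span ℚ (Set.range (PiTensorProduct.tprod ℚ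
      (s := fun _ : toyIndex.Caps j => scalShells.Packet1 (toyIndex.over v)))) := by
    rw [PiTensorProduct.span_tprod_eq_top]; trivial
  refine Submodule.span_mono ?_ hx
  rintro _ ⟨y, rfl⟩
  exact ⟨y, fun w hw => absurd (Subsingleton.elim _ _) hw, rfl⟩

variable [hp : Fact p.Prime]

/-- **(i) HOLDS**: splitting monoids in the sub-packets, the degree clause (degree of `p^k𝒪` = global log-volume of `B_k`), and the
multiradial compatibility (the data of all vertical lines coincide — for the LARGER group as for the signs). [folklore] -/
theorem scal_partI : (scalFull p).PartI := by
  refine ⟨fun n v hv x _ j => ?_, fun n j k => ⟨fun vQ => Or.inr ⟨k, rfl⟩, Set.toFinite _, ?_⟩, fun _ _ => rfl⟩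
  · show x j ∈ scalShells.SubPacket j.1 v
    rw [subPacket_eq_top]; trivial
  · rw [finsum_unique]
    exact (pVol_pBall p j.1 _ k).symm

omit hp in
/-- **(ii) HOLDS**, column by column (KummerA: the sign twist fixes balls and `univ`; KummerB: `Ψ_v` is torsion-saturated; KummerC: the
twist is onto; (Ind3): `B_{m'+1} ⊆ B_0`). [folklore] -/
theorem scal_partII : (scalFull p).toLatticeSituation.PartII := by
  intro n
  refine (Column.partII_iff _ _).2 ⟨?_, fun m v hv => image_Psi_of_actsBySigns p (twist_actsBySigns m) v,
    fun m j => Set.image_univ_of_surjective (scalShells.globalAut (twist m) j.1).surjective, ?_⟩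
  · rintro m j vQ A (⟨hj, rfl⟩ | ⟨k, rfl⟩)
    · have hu : twist m j vQ '' (Set.univ : Set (scalShells.Packet j vQ)) = Set.univ :=
        Set.image_univ_of_surjective (twist m j vQ).surjective
      exact ⟨Or.inl ⟨hj, hu⟩, congrArg (pVol p j vQ) hu⟩
    · exact ⟨Or.inr ⟨k, image_pBall_twist p m j vQ k⟩, by
        show pVol p j vQ (twist m j vQ '' pBall p j vQ k) = pVol p j vQ (pBall p j vQ k)
        rw [image_pBall_twist]⟩
  · exact ⟨fun m m' j vQ _ => pBall_mono p j vQ (by omega), fun m j vQ h => absurd trivial h⟩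

/-- **(iii) HOLDS** (w5-d247's link data: squares of full poly-isomorphisms, the abelian commutation of `(−1)^m` with `ℤˣ`, and the
"up to (Ind1), (Ind2), (Ind3)" clauses from (i)). [folklore] -/
theorem scal_partIII : (scalFull p).PartIII := by
  refine ⟨naiveLink.partIIIa_holds, naiveLink.partIIIb_holds, ?_, ?_,
    (scalFull p).evalCompatUpToInd_of_multiradialCompat (scal_partI p).2.2⟩
  · refine naiveLink.partIIIc_of_full (fun _ => rfl) fun n m => ?_
    rintro _ ⟨a, rfl⟩
    show unitIso a ≪≫ unitIso ((-1) ^ m.natAbs) = unitIso ((-1) ^ m.natAbs) ≪≫ unitIso a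
    rw [unitIso_trans, unitIso_trans, mul_comm]
  · intro n m; exact Thm311.PolyIsoCalc.stabilized_full _ _

/-- **The typed [IUTchIII] Theorem 3.11 (i) ∧ (ii) ∧ (iii) HOLDS for the Joshi-style instantiation** (E-cx sign-off (ii): proved, not
assumed). [folklore] -/
theorem scalFull_statement : (scalFull p).Statement := ⟨scal_partI p, scal_partII p, scal_partIII p⟩

/-! ## 3. The setting: honest object side, glue reading the objects, zero-label convention -/

omit hp in
/-- The ONE-HULL-SET frame on a type: the only hull-set is everything (the zero-label convention of the module docstring; never read
by Cor. 3.12). [folklore] -/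
def univFrame (X : Type) : HullFrame X where
  Hul := {Set.univ}
  IsBounded := fun _ => True
  HasHull := fun _ => True
  hul_bounded := fun _ _ => trivial
  bounded_mono := fun _ _ _ _ => trivial
  exists_hul := fun U _ => ⟨Set.univ, rfl, Set.subset_univ U⟩
  hull_mem := fun U _ _ => by
    show ⋂₀ {H | H ∈ ({Set.univ} : Set (Set X)) ∧ U ⊆ H} = Set.univ
    exact Set.eq_univ_of_forall fun x => Set.mem_sInter.2 fun H hH => by
      rw [Set.mem_singleton_iff.1 hH.1]; trivial

omit hp in
/-- Membership in the one-hull-set frame. [folklore] -/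
theorem mem_univFrame_hul {X : Type} (H : Set X) : H ∈ (univFrame X).Hul ↔ H = Set.univ := Iff.rfl

omit hp in
/-- **The SETTING of Cor. 3.12 for the Joshi-style instantiation**: column `n = 0`; lattice, Frobenioid context and the HONEST object
side (`ExpMonoid` value monoids, exponent-reading Prop. 3.7 output `pinSig`, splitting monoid `⊤` with generator `gen`, q-datum `gen`)
VERBATIM those of the pinned setting of record; glue READING THE OBJECT: the `(n,m)`-Kummer image of the lgp-object of exponent `k` at
`j ∈ 𝔽_l^⋇` is `B_{k·j²}`, the image of the `△`-object of exponent `k` is `B_k`; hull frame the `p`-adic balls at `j ∈ 𝔽_l^⋇`; the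
zero-label convention `univ` at `j = 0` (module docstring). [claim: Mochizuki2012, status: disputed] -/
def scalSetting : Setting (scalSituation p) where
  n := 0
  HT := ℤ × ℤ
  LogLink := fun _ _ => Unit
  IsFull := fun _ => True
  lattice :=
    { theater := fun n m => (n, m)
      distinct := fun p q h => by simpa using h
      logLink := fun _ _ => ()
      logLink_full := fun _ _ => trivial }
  Frd := Unit
  IsoF := fun _ _ => Unit
  Ob := fun _ => ℤ
  realify := id
  Strip := Unit
  IsoS := fun _ _ => Unit
  M := fun _ _ => ExpMonoid
  sig := pinSig
  split := { Msplit := fun _ _ => ⊤, exists_gen := fun _ _ => ⟨⟨gen, trivial⟩, top_gen_isGenerator⟩ }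
  ObΔ := ℤ
  N := fun _ _ => ExpMonoid
  qData :=
    { q := fun _ _ => gen
      q_gen := fun _ _ => gen_isGenerator
      objOf := fun x => (expOf (x () (Set.mem_univ ())) : ℤ) }
  frame := fun j vQ => if j = 0 then univFrame (scalShells.Packet j vQ) else pFrame p j vQ
  hul_adm := fun j vQ H hH => by
    by_cases hj : j = 0
    · rw [if_pos hj] at hH
      exact Or.inl ⟨hj, (mem_univFrame_hul H).1 hH⟩
    · rw [if_neg hj] at hH
      obtain ⟨k, rfl⟩ := hH
      exact Or.inr ⟨k, rfl⟩
  thetaRegionOf := fun _ k j vQ => if j = 0 then Set.univ else pBall p j vQ (k * jsq j)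
  qRegionOf := fun k j vQ => if j = 0 then Set.univ else pBall p j vQ k
  qRegion_mem := fun j vQ => by
    by_cases hj : j = 0
    · rw [if_pos hj, if_pos hj]
      exact (mem_univFrame_hul _).2 rfl
    · rw [if_neg hj, if_neg hj]
      exact ⟨_, rfl⟩
  qSupport_finite := fun _ => Set.toFinite _

omit hp in
/-- The frame at a label of `𝔽_l^⋇` is the honest ball frame of the model of record. [folklore] -/
theorem scalSetting_frame_of_ne_zero {j : toyIndex.Label} (hj : j ≠ 0) (vQ : toyIndex.VQ) :
    (scalSetting p).frame j vQ = pFrame p j vQ := by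
  show (if j = 0 then univFrame (scalShells.Packet j vQ) else pFrame p j vQ) = _
  rw [if_neg hj]

omit hp in
/-- … at the zero label it is the one-hull-set frame. [folklore] -/
theorem scalSetting_frame_zero (vQ : toyIndex.VQ) : (scalSetting p).frame 0 vQ = univFrame (scalShells.Packet 0 vQ) := by
  show (if (0 : toyIndex.Label) = 0 then univFrame (scalShells.Packet 0 vQ) else pFrame p 0 vQ) = _
  rw [if_pos rfl]

omit hp in
/-- **The Θ-pilot object is the lgp-object of exponent `1`** (for whichever generator up to torsion Def. 3.8 (i) picks). [folklore] -/
theorem scalSetting_thetaPilot : (scalSetting p).thetaPilot = (1 : ℤ) :=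
  congrArg (Nat.cast : ℕ → ℤ)
    (expOf_eq_one_of_isGenerator_top (Classical.choose_spec ((scalSetting p).split.exists_gen () (Set.mem_univ ()))))

omit hp in
/-- **The q-pilot object is the `△`-object of exponent `1`.** [folklore] -/
theorem scalSetting_qPilot : (scalSetting p).qPilot = (1 : ℤ) := rfl

omit hp in
/-- The `(n,m)`-Kummer image of the Θ-pilot object: `B_{j²}` at `j ∈ 𝔽_l^⋇` (COMPUTED from the object), the convention `univ` at
`j = 0`. [folklore] -/
theorem scalSetting_thetaRegion (m : ℤ) (j : toyIndex.Label) (vQ : toyIndex.VQ) :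
    (scalSetting p).thetaRegion m j vQ = if j = 0 then Set.univ else pBall p j vQ (jsq j) := by
  unfold Setting.thetaRegion
  rw [scalSetting_thetaPilot]
  show (if j = 0 then Set.univ else pBall p j vQ ((1 : ℤ) * jsq j)) = _
  rw [one_mul]

omit hp in
/-- … so `B_{j²}` at every label of `𝔽_l^⋇` — the Θ-REGIONS ARE THE PINNED ONES (E-cx sign-off (i)). [folklore] -/
theorem scalSetting_thetaRegion_of_ne_zero (m : ℤ) {j : toyIndex.Label} (hj : j ≠ 0) (vQ : toyIndex.VQ) :
    (scalSetting p).thetaRegion m j vQ = pBall p j vQ (jsq j) := by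
  rw [scalSetting_thetaRegion, if_neg hj]

omit hp in
/-- The (Ind3)-enlarged Θ-region (no `m`-drift). [folklore] -/
theorem scalSetting_thetaRegion3 (j : toyIndex.Label) (vQ : toyIndex.VQ) :
    (scalSetting p).thetaRegion3 j vQ = if j = 0 then Set.univ else pBall p j vQ (jsq j) := by
  show (⋃ m : ℤ, (scalSetting p).thetaRegion m j vQ) = _
  simp_rw [scalSetting_thetaRegion]
  exact Set.iUnion_const _

omit hp in
/-- … `= B_{j²}` at `j ∈ 𝔽_l^⋇`. [folklore] -/
theorem scalSetting_thetaRegion3_of_ne_zero {j : toyIndex.Label} (hj : j ≠ 0) (vQ : toyIndex.VQ) :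
    (scalSetting p).thetaRegion3 j vQ = pBall p j vQ (jsq j) := by
  rw [scalSetting_thetaRegion3, if_neg hj]

omit hp in
/-- The image of the q-pilot object: `B_1 = q·𝒪` at `j ∈ 𝔽_l^⋇` (computed from the object), `univ` at `j = 0`. [folklore] -/
theorem scalSetting_qRegion (j : toyIndex.Label) (vQ : toyIndex.VQ) :
    (scalSetting p).qRegion j vQ = if j = 0 then Set.univ else pBall p j vQ 1 := rfl

omit hp in
/-- … `= B_1` at `j ∈ 𝔽_l^⋇`. [folklore] -/
theorem scalSetting_qRegion_of_ne_zero {j : toyIndex.Label} (hj : j ≠ 0) (vQ : toyIndex.VQ) :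
    (scalSetting p).qRegion j vQ = pBall p j vQ 1 := by
  rw [scalSetting_qRegion, if_neg hj]

/-- **THE POSSIBLE IMAGES OF THE Θ-PILOT OBJECT ARE ALL THE BALLS.** At a label `j ∈ 𝔽_l^⋇`: every element of `⟨(Ind1) ∪ (Ind2)⟩`
is a scalar `c ≠ 0` on the packet line and carries `B_{j²}` to `B_{j²+v_p(c)}`; conversely `B_e` is reached by the (Ind2)-family
`scaleFamily (p^{e−j²})`. (Model of record: `{B_{j²}}` only, `pinnedSetting_possibleImages`.) [folklore] -/
theorem scalSetting_possibleImages {j : toyIndex.Label} (hj : j ≠ 0) (vQ : toyIndex.VQ) :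
    (scalSetting p).possibleImages j vQ = Set.range (pBall p j vQ) := by
  ext U
  constructor
  · rintro ⟨Φ, -, rfl⟩
    obtain ⟨c, hc, h⟩ := exists_scalar j vQ (Φ j vQ)
    rw [scalSetting_thetaRegion3_of_ne_zero p hj]
    exact ⟨_, (image_pBall_of_scalar p hc h _).symm⟩
  · rintro ⟨e, rfl⟩
    refine ⟨scaleFamily fun _ => ppowUnit p (e - jsq j), scaleFamily_mem_closure _, ?_⟩
    rw [scalSetting_thetaRegion3_of_ne_zero p hj, image_pBall_scaleFamily]
    show pBall p j vQ e = pBall p j vQ (jsq j + padicValRat p ((p : ℚ) ^ (e - jsq j)))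
    rw [padicValRat_ppow, add_sub_cancel]

omit hp in
/-- At the zero label the only possible image is the convention `univ`. [folklore] -/
theorem scalSetting_possibleImages_zero (vQ : toyIndex.VQ) : (scalSetting p).possibleImages 0 vQ = {Set.univ} := by
  ext U
  constructor
  · rintro ⟨Φ, -, rfl⟩
    rw [scalSetting_thetaRegion3, if_pos rfl]
    exact Set.image_univ_of_surjective (Φ 0 vQ).surjective
  · rintro rfl
    refine ⟨1, (Setting.indGroup (scalSituation p)).one_mem, ?_⟩
    rw [scalSetting_thetaRegion3, if_pos rfl]
    exact (Set.image_univ_of_surjective ((1 : scalShells.PacketAut) 0 vQ).surjective).symm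

/-- **The union of the possible images at a label of `𝔽_l^⋇` is THE WHOLE PACKET LINE** (every point of valuation `e` lies in `B_e`).
[folklore] -/
theorem scalSetting_sUnion_possibleImages {j : toyIndex.Label} (hj : j ≠ 0) (vQ : toyIndex.VQ) :
    ⋃₀ (scalSetting p).possibleImages j vQ = Set.univ := by
  rw [scalSetting_possibleImages p hj]
  refine Set.eq_univ_of_forall fun x => Set.mem_sUnion.2 ⟨pBall p j vQ (padicValRat p (line j vQ x)), ⟨_, rfl⟩, ?_⟩
  by_cases h0 : line j vQ x = 0
  · exact Or.inl h0
  · exact Or.inr le_rfl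

end Summit.ABC.IUTFork.Joshi.IsmScaling

end
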